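import Mathlib
import HarnessLib
import Literature.Analysis.FluidPDE.LocalPressureLiouvilleKernel
import Literature.Analysis.FluidPDE.LocalPressureOscillationTools
import Literature.Analysis.FluidPDE.HarmonicProbe

/-!
# Route `PoloidalWindowDoor`, crux `PoloidalWindowRigidity` (K2, stmt-NavierStokesRegularity-19708) —
# SCALING OF THE REGULARISED NEWTONIAN PROFILE: the `L¹` sizes of `Dλ_R`, `D²λ_R`, `Δλ_R`, `D³Φ_R`

Cell ns-regularity-ideate, seat nsreg-p7 (gen 6, third worker under the K2 lead; `--supports stmt-…-19708`).
Brick of the discharge of the K2 lead's hypothesis (F1) (`…LargeScaleEnergy`, `hBMO`).  The slice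
pressure-gradient functional `g^δ(c) = ∫ [q ∂ₑλ_δ(c − ·) + D³Φ_δ(c − ·)(e)(w, w)]` does not depend on `δ`
(sibling `…PressureGradientIdentity`), so it may be evaluated at a LARGE scale `δ = R`, where `λ_R = ΔΦ_R` is a
unit-mass bump of width `R`.  Since `Φ_R(z) = R⁻¹Φ₁(R⁻¹z)` literally (`newtonReg`), every kernel that occurs is
an exact rescaling, and this file records the resulting `L¹` sizes:

* `laplacian_newtonReg_eq_smul_comp`, `fderiv_laplacian_newtonReg_eq`, `fderiv2_laplacian_newtonReg_eq`,
  `laplacian_laplacian_newtonReg_eq`, `fderiv3_newtonReg_eq` — the pointwise scaling laws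
  (`λ_R = R⁻³λ₁(R⁻¹·)`, `Dλ_R = R⁻⁴(Dλ₁)(R⁻¹·)`, `D²λ_R = R⁻⁵(D²λ₁)(R⁻¹·)`, `Δλ_R = R⁻⁵(Δλ₁)(R⁻¹·)`,
  `D³Φ_R = R⁻⁴(D³Φ₁)(R⁻¹·)`; tree `fderiv_const_smul_comp_smul`, `laplacian_const_smul_comp_smul`);
* `integral_norm_fderiv_laplacian_newtonReg` (`= R⁻¹ ∫‖Dλ₁‖`), `integral_norm_fderiv2_laplacian_newtonReg`
  (`= R⁻² ∫‖D²λ₁‖`), `integral_norm_laplacian_laplacian_newtonReg` (`= R⁻² ∫‖Δλ₁‖`),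
  `integral_norm_fderiv3_newtonReg` (`= R⁻¹ ∫‖D³Φ₁‖`, with `‖D³Φ₁‖ ∈ L¹` from the tree's decay
  `O((1+|z|)⁻⁴)`) — change of variables `∫ f(R⁻¹z) dz = R³ ∫ f`.

WHAT THIS IS NOT: not a claim about Navier–Stokes regularity and not the open residue S2⁗ — scaling
bookkeeping for a fixed smooth profile (bears_on LADDER-NS N0 via crux K2 = stmt-19708; whole-class tool).
-/

noncomputable section

-- the summit and its single sub-problem share the name (CONVENTIONS §1), as in every Theorems file
set_option linter.dupNamespace false
-- nested operator types `ℝ³ →L[ℝ] ℝ³ →L[ℝ] ℝ³ →L[ℝ] ℝ`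
set_option maxSynthPendingDepth 3

namespace Summit.NavierStokesRegularity.NavierStokesRegularity.Theorems.PoloidalWindowDoorPoloidalWindowRigidityProfileScaling

open MeasureTheory Set Function Filter Topology Metric InnerProductSpace
open scoped RealInnerProductSpace ENNReal NNReal Laplacian ContDiff
open Literature.Analysis Literature.Analysis.FluidPDE

/-! ## Pointwise scaling laws -/

/-- `Φ_R = R⁻¹ • Φ₁(R⁻¹ ·)` with `Φ₁ = newtonFar (1/2) 1` (the definition of `newtonReg`, as functions). -/
theorem newtonReg_eq_smul_comp (R : ℝ) :
    newtonReg R = fun z : EuclideanSpace ℝ (Fin 3) => R⁻¹ • newtonFar (1 / 2) 1 (R⁻¹ • z) := by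
  funext z; rw [newtonReg, smul_eq_mul]

/-- `Φ₁ = newtonReg 1`. -/
theorem newtonFar_eq_newtonReg_one :
    newtonFar (1 / 2) 1 = newtonReg (1 : ℝ) := by
  funext z; rw [newtonReg, inv_one, one_smul, one_mul]

/-- `λ_R = R⁻³ • λ₁(R⁻¹ ·)` (`λ_R = ΔΦ_R`, `λ₁ = newtonFarLaplacian (1/2) 1`), `R > 0`. [folklore] -/
theorem laplacian_newtonReg_eq_smul_comp {R : ℝ} (hR : 0 < R) :
    Δ (newtonReg R) = fun z : EuclideanSpace ℝ (Fin 3) =>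
      (R⁻¹ ^ 3) • newtonFarLaplacian (1 / 2) 1 (R⁻¹ • z) := by
  funext z; rw [laplacian_newtonReg_eq_scale hR z, smul_eq_mul]

/-- `Dλ_R(z) = R⁻⁴ • (Dλ₁)(R⁻¹z)`. [folklore] -/
theorem fderiv_laplacian_newtonReg_eq {R : ℝ} (hR : 0 < R) (z : EuclideanSpace ℝ (Fin 3)) :
    fderiv ℝ (Δ (newtonReg R)) z =
      (R⁻¹ ^ 3 * R⁻¹) • fderiv ℝ (newtonFarLaplacian (1 / 2) 1) (R⁻¹ • z) := by
  rw [laplacian_newtonReg_eq_smul_comp hR,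
    fderiv_const_smul_comp_smul (newtonFarLaplacian (1 / 2) 1) (R⁻¹ ^ 3) (inv_ne_zero hR.ne')]

/-- `D²λ_R(z) = R⁻⁵ • (D²λ₁)(R⁻¹z)`. [folklore] -/
theorem fderiv2_laplacian_newtonReg_eq {R : ℝ} (hR : 0 < R) (z : EuclideanSpace ℝ (Fin 3)) :
    fderiv ℝ (fderiv ℝ (Δ (newtonReg R))) z =
      (R⁻¹ ^ 3 * R⁻¹ * R⁻¹) • fderiv ℝ (fderiv ℝ (newtonFarLaplacian (1 / 2) 1)) (R⁻¹ • z) := by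
  have h1 : fderiv ℝ (Δ (newtonReg R)) = fun z : EuclideanSpace ℝ (Fin 3) =>
      (R⁻¹ ^ 3 * R⁻¹) • fderiv ℝ (newtonFarLaplacian (1 / 2) 1) (R⁻¹ • z) :=
    funext (fderiv_laplacian_newtonReg_eq hR)
  rw [h1, fderiv_const_smul_comp_smul (fderiv ℝ (newtonFarLaplacian (1 / 2) 1)) (R⁻¹ ^ 3 * R⁻¹)
    (inv_ne_zero hR.ne')]

/-- `Δλ_R(z) = R⁻⁵ (Δλ₁)(R⁻¹z)`. [folklore] -/
theorem laplacian_laplacian_newtonReg_eq {R : ℝ} (hR : 0 < R) (z : EuclideanSpace ℝ (Fin 3)) :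
    Δ (Δ (newtonReg R)) z = (R⁻¹ ^ 3 * R⁻¹ ^ 2) • Δ (newtonFarLaplacian (1 / 2) 1) (R⁻¹ • z) := by
  rw [laplacian_newtonReg_eq_smul_comp hR,
    laplacian_const_smul_comp_smul (newtonFarLaplacian (1 / 2) 1) (R⁻¹ ^ 3) (inv_ne_zero hR.ne')]

/-- `D³Φ_R(z) = R⁻⁴ • (D³Φ₁)(R⁻¹z)`. [folklore] -/
theorem fderiv3_newtonReg_eq {R : ℝ} (hR : 0 < R) (z : EuclideanSpace ℝ (Fin 3)) :
    fderiv ℝ (fderiv ℝ (fderiv ℝ (newtonReg R))) z =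
      (R⁻¹ * R⁻¹ * R⁻¹ * R⁻¹) •
        fderiv ℝ (fderiv ℝ (fderiv ℝ (newtonReg (1 : ℝ)))) (R⁻¹ • z) := by
  have hR0 : R⁻¹ ≠ 0 := inv_ne_zero hR.ne'
  have h1 : fderiv ℝ (newtonReg R) = fun z : EuclideanSpace ℝ (Fin 3) =>
      (R⁻¹ * R⁻¹) • fderiv ℝ (newtonReg (1 : ℝ)) (R⁻¹ • z) := by
    rw [newtonReg_eq_smul_comp R, newtonFar_eq_newtonReg_one]
    exact fderiv_const_smul_comp_smul (newtonReg (1 : ℝ)) R⁻¹ hR0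
  have h2 : fderiv ℝ (fderiv ℝ (newtonReg R)) = fun z : EuclideanSpace ℝ (Fin 3) =>
      (R⁻¹ * R⁻¹ * R⁻¹) • fderiv ℝ (fderiv ℝ (newtonReg (1 : ℝ))) (R⁻¹ • z) := by
    rw [h1]; exact fderiv_const_smul_comp_smul (fderiv ℝ (newtonReg (1 : ℝ))) (R⁻¹ * R⁻¹) hR0
  rw [h2, fderiv_const_smul_comp_smul (fderiv ℝ (fderiv ℝ (newtonReg (1 : ℝ)))) (R⁻¹ * R⁻¹ * R⁻¹) hR0]

/-! ## `L¹` sizes -/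

/-- Change of variables `∫ ‖a • g(R⁻¹ z)‖ dz = |a| R³ ∫ ‖g‖` on `ℝ³`. [folklore] -/
theorem integral_norm_smul_comp_inv_smul {F : Type*} [NormedAddCommGroup F] [NormedSpace ℝ F]
    (g : EuclideanSpace ℝ (Fin 3) → F) (a : ℝ) {R : ℝ} (hR : 0 < R) :
    ∫ z : EuclideanSpace ℝ (Fin 3), ‖a • g (R⁻¹ • z)‖ = |a| * R ^ 3 * ∫ z, ‖g z‖ := by
  have h1 : (fun z : EuclideanSpace ℝ (Fin 3) => ‖a • g (R⁻¹ • z)‖) =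
      fun z => |a| * (fun w => ‖g w‖) (R⁻¹ • z) := by
    funext z; rw [norm_smul, Real.norm_eq_abs]
  rw [h1, integral_const_mul, Measure.integral_comp_inv_smul_of_nonneg volume (fun w => ‖g w‖) hR.le,
    finrank_euclideanSpace_fin, smul_eq_mul, mul_assoc]

/-- **`∫ ‖Dλ_R‖ = R⁻¹ ∫ ‖Dλ₁‖`.** [folklore] -/
theorem integral_norm_fderiv_laplacian_newtonReg {R : ℝ} (hR : 0 < R) :
    ∫ z : EuclideanSpace ℝ (Fin 3), ‖fderiv ℝ (Δ (newtonReg R)) z‖ =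
      R⁻¹ * ∫ z : EuclideanSpace ℝ (Fin 3), ‖fderiv ℝ (newtonFarLaplacian (1 / 2) 1) z‖ := by
  simp_rw [fderiv_laplacian_newtonReg_eq hR]
  rw [integral_norm_smul_comp_inv_smul _ _ hR, abs_of_pos (by positivity)]
  congr 1
  field_simp

/-- **`∫ ‖D²λ_R‖ = R⁻² ∫ ‖D²λ₁‖`.** [folklore] -/
theorem integral_norm_fderiv2_laplacian_newtonReg {R : ℝ} (hR : 0 < R) :
    ∫ z : EuclideanSpace ℝ (Fin 3), ‖fderiv ℝ (fderiv ℝ (Δ (newtonReg R))) z‖ =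
      R⁻¹ ^ 2 * ∫ z : EuclideanSpace ℝ (Fin 3), ‖fderiv ℝ (fderiv ℝ (newtonFarLaplacian (1 / 2) 1)) z‖ := by
  simp_rw [fderiv2_laplacian_newtonReg_eq hR]
  rw [integral_norm_smul_comp_inv_smul _ _ hR, abs_of_pos (by positivity)]
  congr 1
  field_simp

/-- **`∫ ‖Δλ_R‖ = R⁻² ∫ ‖Δλ₁‖`.** [folklore] -/
theorem integral_norm_laplacian_laplacian_newtonReg {R : ℝ} (hR : 0 < R) :
    ∫ z : EuclideanSpace ℝ (Fin 3), ‖Δ (Δ (newtonReg R)) z‖ =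
      R⁻¹ ^ 2 * ∫ z : EuclideanSpace ℝ (Fin 3), ‖Δ (newtonFarLaplacian (1 / 2) 1) z‖ := by
  have h1 : (fun z : EuclideanSpace ℝ (Fin 3) => ‖Δ (Δ (newtonReg R)) z‖) =
      fun z => ‖(R⁻¹ ^ 3 * R⁻¹ ^ 2) • Δ (newtonFarLaplacian (1 / 2) 1) (R⁻¹ • z)‖ := by
    funext z; rw [laplacian_laplacian_newtonReg_eq hR]
  rw [h1, integral_norm_smul_comp_inv_smul _ _ hR, abs_of_pos (by positivity)]
  congr 1
  field_simp

/-- `‖D³Φ₁‖ ∈ L¹(ℝ³)` (decay `O((1+|z|)⁻⁴)` of the tree). [folklore] -/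
theorem integrable_norm_fderiv3_newtonReg_one :
    Integrable (fun z : EuclideanSpace ℝ (Fin 3) =>
      ‖fderiv ℝ (fderiv ℝ (fderiv ℝ (newtonReg (1 : ℝ)))) z‖) volume := by
  obtain ⟨C, hC0, hC⟩ := exists_norm_fderiv3_newtonReg_le_inv (δ := (1 : ℝ)) one_pos
  have hint : Integrable (fun z : EuclideanSpace ℝ (Fin 3) => C * (1 + ‖z‖) ^ (-(4 : ℝ))) volume := by
    refine (integrable_one_add_norm ?_).const_mul C
    rw [finrank_euclideanSpace_fin]; norm_num
  refine Integrable.mono' hint (continuous_fderiv3_newtonReg (1 : ℝ)).norm.aestronglyMeasurable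
    (Eventually.of_forall fun z => ?_)
  rw [norm_norm]
  refine (hC z).trans (le_of_eq ?_)
  rw [Real.rpow_neg (by positivity), show (4 : ℝ) = ((4 : ℕ) : ℝ) by norm_num, Real.rpow_natCast]

/-- **`∫ ‖D³Φ_R‖ = R⁻¹ ∫ ‖D³Φ₁‖`.** [folklore] -/
theorem integral_norm_fderiv3_newtonReg {R : ℝ} (hR : 0 < R) :
    ∫ z : EuclideanSpace ℝ (Fin 3), ‖fderiv ℝ (fderiv ℝ (fderiv ℝ (newtonReg R))) z‖ =
      R⁻¹ * ∫ z : EuclideanSpace ℝ (Fin 3), ‖fderiv ℝ (fderiv ℝ (fderiv ℝ (newtonReg (1 : ℝ)))) z‖ := by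
  simp_rw [fderiv3_newtonReg_eq hR]
  rw [integral_norm_smul_comp_inv_smul (fderiv ℝ (fderiv ℝ (fderiv ℝ (newtonReg (1 : ℝ)))))
    (R⁻¹ * R⁻¹ * R⁻¹ * R⁻¹) hR, abs_of_pos (by positivity)]
  congr 1
  field_simp

/-- **Uniform bound for the velocity term at scale `R`:**
`∫ ‖D³Φ_R(c − x)‖ ‖w x‖² dx ≤ M² R⁻¹ ∫‖D³Φ₁‖` for `|w| ≤ M`. [folklore] -/
theorem integral_norm_fderiv3_newtonReg_comp_sub_mul_le {R M : ℝ} (hR : 0 < R)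
    {w : EuclideanSpace ℝ (Fin 3) → EuclideanSpace ℝ (Fin 3)}
    (hM : ∀ x, ‖w x‖ ≤ M) (c e : EuclideanSpace ℝ (Fin 3)) :
    |∫ x, evalDiag (w x) (fderiv ℝ (fderiv ℝ (fderiv ℝ (newtonReg R))) (c - x) e)| ≤
      M ^ 2 * ‖e‖ * (R⁻¹ * ∫ z : EuclideanSpace ℝ (Fin 3), ‖fderiv ℝ (fderiv ℝ (fderiv ℝ (newtonReg (1 : ℝ)))) z‖) := by
  have hM0 : 0 ≤ M := (norm_nonneg _).trans (hM 0)
  set K3 := fderiv ℝ (fderiv ℝ (fderiv ℝ (newtonReg R))) with hK3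
  have hKi : Integrable (fun x : EuclideanSpace ℝ (Fin 3) => ‖K3 (c - x)‖) volume := by
    have h1 : Integrable (fun z : EuclideanSpace ℝ (Fin 3) => ‖K3 z‖) volume := by
      simp_rw [hK3, fderiv3_newtonReg_eq hR]
      have h := (integrable_norm_fderiv3_newtonReg_one.comp_smul (inv_ne_zero hR.ne')).const_mul
        |R⁻¹ * R⁻¹ * R⁻¹ * R⁻¹|
      refine h.congr (Eventually.of_forall fun z => ?_)
      simp only [norm_smul, Real.norm_eq_abs]
    exact h1.comp_sub_left c
  have hpt : ∀ x, ‖evalDiag (w x) (K3 (c - x) e)‖ ≤ M ^ 2 * ‖e‖ * ‖K3 (c - x)‖ := by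
    intro x
    calc ‖evalDiag (w x) (K3 (c - x) e)‖ ≤ ‖evalDiag (w x)‖ * ‖K3 (c - x) e‖ :=
          ContinuousLinearMap.le_opNorm _ _
      _ ≤ ‖w x‖ ^ 2 * (‖K3 (c - x)‖ * ‖e‖) :=
          mul_le_mul (norm_evalDiag_le _) (ContinuousLinearMap.le_opNorm _ _) (norm_nonneg _) (by positivity)
      _ ≤ M ^ 2 * (‖K3 (c - x)‖ * ‖e‖) := by
          refine mul_le_mul_of_nonneg_right ?_ (by positivity)
          exact pow_le_pow_left₀ (norm_nonneg _) (hM x) 2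
      _ = M ^ 2 * ‖e‖ * ‖K3 (c - x)‖ := by ring
  calc |∫ x, evalDiag (w x) (K3 (c - x) e)| = ‖∫ x, evalDiag (w x) (K3 (c - x) e)‖ := (Real.norm_eq_abs _).symm
    _ ≤ ∫ x, M ^ 2 * ‖e‖ * ‖K3 (c - x)‖ := norm_integral_le_of_norm_le (hKi.const_mul _) (Eventually.of_forall hpt)
    _ = M ^ 2 * ‖e‖ * ∫ x, ‖K3 (c - x)‖ := integral_const_mul _ _
    _ = M ^ 2 * ‖e‖ * ∫ z, ‖K3 z‖ := by rw [integral_sub_left_eq_self (fun z => ‖K3 z‖) volume c]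
    _ = _ := by rw [hK3, integral_norm_fderiv3_newtonReg hR]

end Summit.NavierStokesRegularity.NavierStokesRegularity.Theorems.PoloidalWindowDoorPoloidalWindowRigidityProfileScaling

end
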